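import Literature.Geometry.GeometricMeasureTheory.BoundaryRectifiability
import Literature.Geometry.GeometricMeasureTheory.SliceableCycles
import Literature.Geometry.GeometricMeasureTheory.SkeletonRetract
import Literature.Geometry.GeometricMeasureTheory.SkeletonRetractDimOne
import Literature.Geometry.GeometricMeasureTheory.SkeletonSliceRectifiable
import Literature.Geometry.GeometricMeasureTheory.ZeroCurrentIntegrality
import HarnessLib

/-!
# Proof of Federer's boundary rectifiability theorem (4.2.16 (2))

This file discharges the named fact
`Literature.Geometry.GeometricMeasureTheory.Federer1969_boundaryRectifiability`
(`BoundaryRectifiability.lean`): **the boundary of a rectifiable current `S ∈ 𝓡_{m+1}(V)` with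
`𝐌(∂S) < ∞` is rectifiable**, `∂S ∈ 𝓡_m(V)` [Federer1969, 4.2.16 (2)]. (It is a separate file
because the statement file is imported, through `Kaehler/TangentConeFlatReduction.lean`, by the
closure-theorem files used in the proof.)

The proof follows B. White's route [White1989, §1.5; Bandara2006, Thm. 4.2.2] by induction on
the dimension, with Federer's deformation retraction (4.2.9) in place of polyhedral approximation:

* `m = 0` (`Current.IsRectifiable.isRectifiable_boundary_one`): retract `S ∈ 𝓡_1` onto the
  `1`-skeleton at scales `εₖ ↓ 0` (`Current.IsRectifiable.exists_skeleton_retract_one`: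
  `S − Qₖ = Rₖ + ∂Hₖ`, `𝐌(Rₖ) ≤ εₖ γ' 𝐌(∂S)`); the ball values of `∂Qₖ` are integers
  (`Current.IsRectifiable.ae_isRectifiable_sphereSlice`: sphere slices of a current carried by the
  skeleton are finite integral chains), those of `∂Rₖ` are values of slices of `Rₖ`, whose masses
  tend to `0` in `k` at almost every radius (slicing inequality, `Σ εₖ < ∞`); hence `∂S` has
  integer ball values and `Current.isRectifiable_zero_of_ae_int_ball` applies.
* `m = k + 1` (`Current.IsRectifiable.isRectifiable_boundary_succ`): retract `S ∈ 𝓡_{k+2}` onto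
  the `(k+2)`-skeleton (`Current.IsRectifiable.exists_skeleton_retract`); the cycles
  `Zᵢ = ∂Qᵢ → ∂S` weakly with bounded masses and supports, and `∂(Zᵢ ⌞ 𝐁(x,r)) = −∂σ` where
  `σ = ∂(Qᵢ ⌞ 𝐁) − Zᵢ ⌞ 𝐁 ∈ 𝓡_{k+1}` has `𝐌(∂σ) < ∞` for a.e. `r`, so `∂σ ∈ 𝓡_k` by the
  induction hypothesis; the closure theorem for cycles with rectifiable slices
  (`Current.isRectifiable_of_tendsto_cycles_of_slices`) gives `∂S ∈ 𝓡_{k+1}`.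

Also proved here: `Current.eq_zero_of_finrank_lt` (no currents above the dimension),
`Current.IsRepresentable.tendsto_smulFun_closedBall` and
`Current.IsRepresentable.restrictSet_closedBall_add_apply` (`T ⌞ 𝐁(x,r)` as a limit of smooth
truncations, hence additive in `T`). Theorems only; no new definitions, no named facts.

## References

* H. Federer, *Geometric Measure Theory*, Springer 1969, 4.1.7, 4.2.1, 4.2.9, 4.2.16 (held copy
  `lit book:federernd-geometric-measure-theory`, PDF pp. 340–352) [Federer1969].
* B. White, *A new proof of the compactness theorem for integral currents*, Comment. Math.
  Helv. 64 (1989) 207–220, Thm. 1.6 and §1.5 [White1989].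
* L. Bandara, *The closure theorem for integral currents*, honours thesis, ANU 2006, Thm. 4.2.2
  [Bandara2006].
-/

noncomputable section

open scoped ENNReal NNReal Topology ContDiff
open MeasureTheory TopologicalSpace Set Filter Metric Function

namespace Literature.Geometry.GeometricMeasureTheory

-- Nested operator-norm instances on (duals of) `E [⋀^Fin m]→L[ℝ] ℝ`, as in `Currents.lean`.
set_option maxSynthPendingDepth 2

open Cubical

section Proof

variable {V : Type*} [NormedAddCommGroup V] [InnerProductSpace ℝ V] [FiniteDimensional ℝ V]
  [MeasurableSpace V] [BorelSpace V]

omit [MeasurableSpace V] [BorelSpace V] in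
/-- Currents of dimension exceeding `dim V` vanish (there are no nonzero `m`-covectors for
`m > dim V`). [cite: Federer1969, 1.3.2, 4.1.7] -/
theorem Current.eq_zero_of_finrank_lt {m : ℕ} (h : Module.finrank ℝ V < m)
    (T : Current (⊤ : Opens V) m) : T = 0 := by
  have hφ : ∀ φ : TestForm (⊤ : Opens V) m, φ = 0 := fun φ => by
    ext x w
    have hw : ¬LinearIndependent ℝ w := fun hli => by
      have := hli.fintype_card_le_finrank
      rw [Fintype.card_fin] at this
      omega
    have := (φ x).toAlternatingMap.map_linearDependent w hw
    simpa using this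
  ext φ
  rw [hφ φ, map_zero, map_zero]

omit [FiniteDimensional ℝ V] [MeasurableSpace V] [BorelSpace V] in
/-- The exterior derivative of a test form vanishes where the form is locally constant. [folklore] -/
private theorem extDerivCLM_eq_zero_of_eqOn' {m : ℕ} (θ : TestForm (⊤ : Opens V) m) {U : Set V}
    (hU : IsOpen U) (c₀ : Covector V m) (hθ : ∀ x ∈ U, θ x = c₀) {x : V} (hx : x ∈ U) :
    TestForm.extDerivCLM θ x = 0 := by
  have hev : (⇑θ) =ᶠ[𝓝 x] (fun _ => c₀) :=
    Filter.eventuallyEq_of_mem (hU.mem_nhds hx) fun y hy => hθ y hy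
  rw [show TestForm.extDerivCLM θ x = extDeriv ⇑θ x from congrFun (TestForm.extDerivCLM_apply θ) x,
    hev.extDeriv_eq]
  ext v
  rw [extDeriv_apply (differentiableAt_const c₀) v]
  simp

omit [MeasurableSpace V] [BorelSpace V] in
/-- A test `0`-form equal to the unit `0`-covector on a neighbourhood `U` of a compact set, so
that its value on the empty frame is `1` and its exterior derivative vanishes on `U`. [folklore] -/
private theorem exists_testForm_zero_eq_one {K : Set V} (hK : IsCompact K) :
    ∃ (χ : TestForm (⊤ : Opens V) 0) (U : Set V), IsOpen U ∧ K ⊆ U ∧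
      (∀ y ∈ U, χ y ![] = 1) ∧ (∀ y ∈ U, TestForm.extDerivCLM χ y = 0) ∧ ∀ y, ‖χ y‖ ≤ 1 := by
  obtain ⟨f, U, hU, hKU, hf1, hf01⟩ :=
    exists_testFunction_eq_one_nhds (Ω := (⊤ : Opens V)) hK (fun _ _ => trivial)
  set u₀ : Covector V 0 := ContinuousAlternatingMap.constOfIsEmpty ℝ V (Fin 0) (1 : ℝ) with hu₀
  have hcd : ContDiff ℝ ∞ (fun y => f y • u₀) := f.contDiff.smul contDiff_const
  have hcs : HasCompactSupport (fun y => f y • u₀) :=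
    f.hasCompactSupport.comp_left (g := fun t : ℝ => t • u₀) (zero_smul ℝ u₀)
  set χ : TestForm (⊤ : Opens V) 0 := ⟨fun y => f y • u₀, hcd, hcs, fun _ _ => trivial⟩ with hχ
  have hχap : ∀ y, χ y = f y • u₀ := fun y => rfl
  refine ⟨χ, U, hU, hKU, fun y hy => ?_, fun y hy => ?_, fun y => ?_⟩
  · rw [hχap, hf1 y hy, one_smul, hu₀, ContinuousAlternatingMap.constOfIsEmpty_apply]
  · exact extDerivCLM_eq_zero_of_eqOn' _ hU u₀ (fun z hz => by rw [hχap, hf1 z hz, one_smul]) hy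
  · rw [hχap, norm_smul, Real.norm_eq_abs, abs_of_nonneg (hf01 y).1]
    exact mul_le_one₀ (hf01 y).2 (norm_nonneg _) norm_constOfIsEmpty_one_le

/-- Restriction to equal sets. [folklore] -/
private theorem restrictSet_congr_set'' {m : ℕ} {T : Current (⊤ : Opens V) m}
    (hT : T.IsRepresentable) {A B : Set V} (hA : MeasurableSet A) (hB : MeasurableSet B)
    (h : A = B) : hT.restrictSet A hA = hT.restrictSet B hB := by
  subst h; rfl

/-- `(T ⌞ A)(ψ) = 0` when `ψ` vanishes on `spt T` (`T ⌞ A = (‖T‖ ⌞ A) ∧ T⃗` and `‖T‖` lives on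
`spt T`). [cite: Federer1969, 4.1.7] -/
theorem Current.IsRepresentable.restrictSet_apply_eq_zero_of_eqOn_support {m : ℕ}
    {T : Current (⊤ : Opens V) m} (hT : T.IsRepresentable) (hfin : T.mass ≠ ⊤) {A : Set V}
    (hA : MeasurableSet A) {ψ : TestForm (⊤ : Opens V) m} (h : ∀ y ∈ T.support, ψ y = 0) :
    hT.restrictSet A hA ψ = 0 := by
  have hli : LocallyIntegrableOn (hT.polar hfin) ((⊤ : Opens V) : Set V) (T.variation.restrict A) :=
    fun x hx =>
      let ⟨W, hW, hi⟩ := hT.locallyIntegrableOn_polar hfin x hx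
      ⟨W, hW, hi.mono_measure Measure.restrict_le_self⟩
  rw [hT.restrictSet_eq_vectorCurrent_polar hfin A hA, vectorCurrent_apply hli]
  refine integral_eq_zero_of_ae (ae_restrict_of_ae ?_)
  have h0 : T.variation (((⊤ : Opens V) : Set V) \ T.support) = 0 :=
    T.variation_eq_zero_of_disjoint_support T.isOpen_sdiff_support disjoint_sdiff_left
  have : ∀ᵐ y ∂T.variation, y ∈ T.support := by
    rw [ae_iff]
    exact measure_mono_null (fun y hy => show y ∈ ((⊤ : Opens V) : Set V) \ T.support from
      ⟨trivial, hy⟩) h0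
  filter_upwards [this] with y hy
  simp [h y hy]

/-- **The restriction to a closed ball as a limit**: `(T ⌞ 𝐁(x,r))(φ) = limₙ T((1 − gₙ) φ)` for the
smooth approximants `gₙ → 1_{{‖· − x‖² > r²}}` — for every current of finite mass, with the same
`gₙ`. [cite: Federer1969, 4.1.7, 4.2.1] -/
theorem Current.IsRepresentable.tendsto_smulFun_closedBall {m : ℕ} {T : Current (⊤ : Opens V) m}
    (hT : T.IsRepresentable) (x : V) {r : ℝ} (hr : 0 ≤ r) (φ : TestForm (⊤ : Opens V) m) :
    Tendsto (fun n : ℕ => T.smulFun ((contDiff_const (c := (1 : ℝ))).sub (contDiff_sliceApprox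
        ((contDiff_norm_sq ℝ).comp (contDiff_id.sub (contDiff_const (c := x)))) (r ^ 2)
          (1 / ((n : ℝ) + 1)))) φ) atTop
      (𝓝 (hT.restrictSet (closedBall x r) measurableSet_closedBall φ)) := by
  set f : V → ℝ := fun y => ‖y - x‖ ^ 2 with hfdef
  refine hT.tendsto_smulFun_apply (g := fun n y => (1 : ℝ) - sliceApprox f (r ^ 2) (1 / ((n : ℝ) + 1)) y)
    _ (C := 1) (fun n y => ?_) measurableSet_closedBall (Eventually.of_forall fun y => ?_) φ
  · have h1 := abs_sliceApprox_le f (r ^ 2) (1 / ((n : ℝ) + 1)) y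
    have h2 : 0 ≤ sliceApprox f (r ^ 2) (1 / ((n : ℝ) + 1)) y := Real.smoothTransition.nonneg _
    rw [abs_le] at h1 ⊢
    constructor <;> linarith [h1.2]
  · have ht := (tendsto_sliceApprox f (r ^ 2) y).const_sub 1
    refine ht.congr' (Eventually.of_forall fun n => rfl) |>.trans ?_
    have hset : {z | r ^ 2 < f z} = (closedBall x r)ᶜ := by
      ext z
      simp only [hfdef, mem_setOf_eq, mem_compl_iff, mem_closedBall, not_le, dist_eq_norm]
      exact sq_lt_sq₀ hr (norm_nonneg _)
    rw [hset]
    by_cases hy : y ∈ closedBall x r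
    · rw [indicator_of_mem hy, indicator_of_notMem (show y ∉ (closedBall x r)ᶜ from fun h' => h' hy)]
      simp
    · rw [indicator_of_notMem hy, indicator_of_mem (show y ∈ (closedBall x r)ᶜ from hy)]; simp

/-- **Additivity of the restriction to closed balls in the current**: if `T = T₁ + T₂` (all of
finite mass) then `T ⌞ 𝐁(x,r) = T₁ ⌞ 𝐁(x,r) + T₂ ⌞ 𝐁(x,r)` on every test form.
[cite: Federer1969, 4.1.7] -/
theorem Current.IsRepresentable.restrictSet_closedBall_add_apply {m : ℕ}
    {T T₁ T₂ : Current (⊤ : Opens V) m} (hT : T.IsRepresentable) (hT₁ : T₁.IsRepresentable)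
    (hT₂ : T₂.IsRepresentable) (h : T = T₁ + T₂) (x : V) {r : ℝ} (hr : 0 ≤ r)
    (φ : TestForm (⊤ : Opens V) m) :
    hT.restrictSet (closedBall x r) measurableSet_closedBall φ =
      hT₁.restrictSet (closedBall x r) measurableSet_closedBall φ +
        hT₂.restrictSet (closedBall x r) measurableSet_closedBall φ := by
  refine tendsto_nhds_unique (hT.tendsto_smulFun_closedBall x hr φ)
    (((hT₁.tendsto_smulFun_closedBall x hr φ).add (hT₂.tendsto_smulFun_closedBall x hr φ)).congr
      fun n => ?_)
  simp only [Current.smulFun_apply, h]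
  rfl

/-- The measurable majorant of the slice masses of `T` by `‖· − x‖²` at levels in `(0, b)`
integrates to at most `2 C₀ √(b+1) · 𝐌(T)`. [cite: Federer1969, 4.2.1] -/
private theorem lintegral_liminf_sliceWindow_norm_sq_le {k : ℕ} {T : Current (⊤ : Opens V) (k + 1)}
    (hT : T.IsRepresentable) (x : V) (b : ℝ) :
    ∫⁻ s in Ioo 0 b, liminf (fun n => sliceWindow T (fun y => ‖y - x‖ ^ 2) n s) atTop ≤
      ENNReal.ofReal (sliceConst k * (2 * Real.sqrt (b + 1))) * T.mass := by
  have hf : ContDiff ℝ ∞ (fun y : V => ‖y - x‖ ^ 2) :=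
    (contDiff_norm_sq ℝ).comp (contDiff_id.sub contDiff_const)
  refine (hT.lintegral_liminf_sliceWindow_le hf 0 b one_pos).trans ?_
  rw [ENNReal.ofReal_mul (sliceConst_nonneg k), mul_assoc]
  refine mul_le_mul' le_rfl ?_
  have hD : ∀ y ∈ (fun y : V => ‖y - x‖ ^ 2) ⁻¹' Icc 0 (b + 1),
      ‖fderiv ℝ (fun y : V => ‖y - x‖ ^ 2) y‖ₑ ≤ ENNReal.ofReal (2 * Real.sqrt (b + 1)) := by
    intro y hy
    have hdf : HasFDerivAt (fun y : V => ‖y - x‖ ^ 2) (2 • innerSL ℝ (y - x)) y := by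
      have := ((hasFDerivAt_id y).sub_const x).norm_sq
      simpa using this
    rw [hdf.fderiv, ← ofReal_norm]
    refine ENNReal.ofReal_le_ofReal (norm_nsmul_le.trans ?_)
    rw [innerSL_apply_norm, Nat.cast_ofNat]
    refine mul_le_mul_of_nonneg_left ?_ zero_le_two
    rw [← Real.sqrt_sq (norm_nonneg (y - x))]
    exact Real.sqrt_le_sqrt hy.2
  calc ∫⁻ y in (fun y : V => ‖y - x‖ ^ 2) ⁻¹' Icc 0 (b + 1), ‖fderiv ℝ (fun y : V => ‖y - x‖ ^ 2) y‖ₑ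
        ∂T.variation
      ≤ ∫⁻ _ in (fun y : V => ‖y - x‖ ^ 2) ⁻¹' Icc 0 (b + 1), ENNReal.ofReal (2 * Real.sqrt (b + 1))
          ∂T.variation := setLIntegral_mono measurable_const hD
    _ ≤ ENNReal.ofReal (2 * Real.sqrt (b + 1)) * T.mass := by
        rw [setLIntegral_const]
        exact mul_le_mul' le_rfl ((measure_mono (subset_univ _)).trans (T.variation_le_mass _))

/-- **Boundary rectifiability in dimension one** [Federer1969, 4.2.16 (2), `m = 0`]: the boundary
of a rectifiable `1`-current with `𝐌(∂S) < ∞` is a finite integral `0`-chain. Proof (White's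
route): with `S − Qₖ = Rₖ + ∂Hₖ` the skeleton retractions at scales `εₖ = 2^{-k-1}`
(`Current.IsRectifiable.exists_skeleton_retract_one`), the ball values `(∂S ⌞ 𝐁(x,r))(1)` split
as `(∂Qₖ ⌞ 𝐁)(1) + (∂Rₖ ⌞ 𝐁)(1)`; the first is minus the augmentation of the finite integral
chain `∂(Qₖ ⌞ 𝐁) − ∂Qₖ ⌞ 𝐁` (`Current.IsRectifiable.ae_isRectifiable_sphereSlice`), an
integer, the second is minus the value of the slice `⟨Rₖ, ‖·−x‖², r²+⟩` on `1`, and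
`Σₖ ∫ 𝐌⟨Rₖ, ·⟩ < ∞`; so the ball values of `∂S` are integers for a.e. `r`, and
`Current.isRectifiable_zero_of_ae_int_ball` applies.
[cite: Federer1969, 4.2.16; White1989, §1.5; Bandara2006, Thm. 4.2.2] -/
theorem Current.IsRectifiable.isRectifiable_boundary_one {S : Current (⊤ : Opens V) (0 + 1)}
    (hS : S.IsRectifiable) (hdS : S.boundary.mass ≠ ⊤) : S.boundary.IsRectifiable := by
  classical
  set n := Module.finrank ℝ V with hn
  -- degenerate dimension
  rcases Nat.lt_or_ge n 1 with hn0 | hn1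
  · rw [Current.eq_zero_of_finrank_lt (m := 0 + 1) (by omega) S, Current.boundary_zero]
    exact Current.isRectifiable_zero
  set b := stdOrthonormalBasis ℝ V
  obtain ⟨γ', hγ', hret⟩ := Current.IsRectifiable.exists_skeleton_retract_one b hn1
  /- Step 1: the retractions at scales `εₖ`. -/
  set ε : ℕ → ℝ := fun k => (1 / 2 : ℝ) ^ (k + 1) with hεdef
  have hεpos : ∀ k, 0 < ε k := fun k => by positivity
  have hεle : ∀ k, ε k ≤ 1 := fun k => pow_le_one₀ (by norm_num) (by norm_num)
  have hex := fun k => hret (hεpos k) hS hdS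
  choose Q R H hQr hQskel hdQm hQZ hRZ hHZ hdec hRm using hex
  have hSm : S.mass ≠ ⊤ := hS.mass_ne_top'
  have hdQ : ∀ k, (Q k).boundary.mass ≠ ⊤ := fun k => ne_top_of_le_ne_top hdS (hdQm k)
  have hRm' : ∀ k, (R k).mass ≠ ⊤ := fun k =>
    ne_top_of_le_ne_top (ENNReal.mul_ne_top ENNReal.ofReal_ne_top hdS) (hRm k)
  have hdR : ∀ k, (R k).boundary = S.boundary - (Q k).boundary := fun k => by
    have := congrArg Current.boundary (hdec k)
    rw [Current.boundary_sub, Current.boundary_add, Current.boundary_boundary, add_zero] at this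
    exact this.symm
  have hdRm : ∀ k, (R k).boundary.mass ≠ ⊤ := fun k => by
    rw [hdR k, sub_eq_add_neg]
    exact ne_top_of_le_ne_top (ENNReal.add_ne_top.2 ⟨hdS, by rw [Current.mass_neg]; exact hdQ k⟩)
      (Current.mass_add_le _ _)
  -- representability proofs
  set hdSr := S.boundary.isRepresentable_of_mass_ne_top hdS
  have hQr' : ∀ k, (Q k).IsRepresentable := fun k => (Q k).isRepresentable_of_mass_ne_top (hQr k).mass_ne_top'
  have hdQr' : ∀ k, (Q k).boundary.IsRepresentable := fun k =>
    (Q k).boundary.isRepresentable_of_mass_ne_top (hdQ k)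
  have hRr : ∀ k, (R k).IsRepresentable := fun k => (R k).isRepresentable_of_mass_ne_top (hRm' k)
  have hdRr : ∀ k, (R k).boundary.IsRepresentable := fun k =>
    (R k).boundary.isRepresentable_of_mass_ne_top (hdRm k)
  /- Step 2: the compact set `K₀` and the test `0`-form `χ`. -/
  set K₀ : Set V := cthickening (3 * Real.sqrt n) S.support with hK₀
  have hK₀c : IsCompact K₀ := hS.2.cthickening
  have hSK₀ : S.support ⊆ K₀ := self_subset_cthickening _
  have hthick : ∀ k, cthickening (3 * Real.sqrt n * ε k) S.support ⊆ K₀ := fun k =>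
    cthickening_mono (by nlinarith [Real.sqrt_nonneg n, hεle k, hεpos k]) _
  obtain ⟨χ, U, hUo, hK₀U, hχ1, hdχ, hχn⟩ := exists_testForm_zero_eq_one hK₀c
  have hQU : ∀ k, (Q k).support ⊆ U := fun k => ((hQZ k).trans (hthick k)).trans hK₀U
  have hRU : ∀ k, (R k).support ⊆ U := fun k => ((hRZ k).trans (hthick k)).trans hK₀U
  have hdSU : S.boundary.support ⊆ U := (S.support_boundary_subset.trans hSK₀).trans hK₀U
  -- `T(dχ) = 0` for currents supported in `U`
  have hdχ_disj : ∀ {j : ℕ} (T : Current (⊤ : Opens V) j), T.support ⊆ U →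
      Disjoint (tsupport ⇑(TestForm.extDerivCLM χ)) T.support := by
    intro j T hT
    have hsub : tsupport ⇑(TestForm.extDerivCLM χ) ⊆ Uᶜ :=
      closure_minimal (fun y hy hyU => hy (hdχ y hyU)) hUo.isClosed_compl
    exact Set.disjoint_left.2 fun y hy hyT => hsub hy (hT hyT)
  /- Step 3: apply the integer-ball criterion to `Z = ∂S`. -/
  refine Current.isRectifiable_zero_of_ae_int_ball hdS hdSU χ hχ1 fun x => ?_
  set f : V → ℝ := fun y => ‖y - x‖ ^ 2 with hfdef
  have hf : ContDiff ℝ ∞ f := (contDiff_norm_sq ℝ).comp (contDiff_id.sub contDiff_const)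
  /- Step 3a: the slices of `Rₖ` tend to zero at a.e. level. -/
  set G : ℕ → ℝ → ℝ≥0∞ := fun k s => liminf (fun j => sliceWindow (R k) f j s) atTop with hGdef
  have hGm : ∀ k, Measurable (G k) := fun k =>
    Measurable.liminf fun j => measurable_sliceWindow (hRr k) hf j
  have hGslice : ∀ k s, ((hRr k).slice (hdRr k) hf.continuous s).mass ≤ G k s := fun k s =>
    (hRr k).mass_slice_le_liminf (hdRr k) hf s
  have hGint : ∀ (B : ℕ), ∀ᵐ s, s ∈ Ioo (0 : ℝ) B → Tendsto (fun k => G k s) atTop (𝓝 0) := by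
    intro B
    set C : ℝ≥0∞ := ENNReal.ofReal (sliceConst 0 * (2 * Real.sqrt (B + 1))) with hC
    have hk : ∀ k, ∫⁻ s in Ioo (0 : ℝ) B, G k s ≤ C * (ENNReal.ofReal (ε k * γ') * S.boundary.mass) :=
      fun k => (lintegral_liminf_sliceWindow_norm_sq_le (hRr k) x B).trans
        (mul_le_mul' le_rfl (hRm k))
    have hsum : ∫⁻ s in Ioo (0 : ℝ) B, ∑' k, G k s ≠ ⊤ := by
      rw [lintegral_tsum fun k => (hGm k).aemeasurable]
      refine ne_top_of_le_ne_top ?_ (ENNReal.tsum_le_tsum hk)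
      rw [ENNReal.tsum_mul_left]
      refine ENNReal.mul_ne_top ENNReal.ofReal_ne_top ?_
      rw [ENNReal.tsum_mul_right]
      refine ENNReal.mul_ne_top ?_ hdS
      have hgeom : ∑' k, ENNReal.ofReal (ε k * γ') = ENNReal.ofReal γ' * ∑' k, ENNReal.ofReal (ε k) := by
        rw [← ENNReal.tsum_mul_left]
        refine tsum_congr fun k => ?_
        rw [mul_comm, ENNReal.ofReal_mul hγ']
      rw [hgeom]
      refine ENNReal.mul_ne_top ENNReal.ofReal_ne_top ?_
      have : ∑' k, ENNReal.ofReal (ε k) = ENNReal.ofReal 1 := by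
        rw [← ENNReal.ofReal_tsum_of_nonneg (fun k => (hεpos k).le) ?_]
        · congr 1
          simp only [hεdef, pow_succ]
          rw [tsum_mul_right, tsum_geometric_two]; norm_num
        · simp only [hεdef, pow_succ]
          exact summable_geometric_two.mul_right _
      rw [this]; exact ENNReal.ofReal_ne_top
    have hmeas : Measurable fun s => ∑' k, G k s := by
      have : (fun s => ∑' k, G k s) = fun s => ⨆ N : ℕ, ∑ k ∈ Finset.range N, G k s :=
        funext fun s => ENNReal.tsum_eq_iSup_nat
      rw [this]
      exact Measurable.iSup fun N => Finset.measurable_sum _ fun k _ => hGm k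
    have hae := ae_lt_top hmeas hsum
    rw [ae_restrict_iff' measurableSet_Ioo] at hae
    filter_upwards [hae] with s hs hsB
    exact ENNReal.tendsto_atTop_zero_of_tsum_ne_top (hs hsB).ne
  have hRslice : ∀ᵐ s, 0 < s →
      Tendsto (fun k => (hRr k).slice (hdRr k) hf.continuous s χ) atTop (𝓝 0) := by
    have hall := ae_all_iff.2 hGint
    filter_upwards [hall] with s hs hs0
    obtain ⟨B, hB⟩ := exists_nat_gt s
    have hG0 : Tendsto (fun k => G k s) atTop (𝓝 0) := hs B ⟨hs0, hB⟩
    have hM0 : Tendsto (fun k => ((hRr k).slice (hdRr k) hf.continuous s).mass) atTop (𝓝 0) :=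
      tendsto_of_tendsto_of_tendsto_of_le_of_le tendsto_const_nhds hG0 (fun k => bot_le)
        fun k => hGslice k s
    have hM0' : Tendsto (fun k => (((hRr k).slice (hdRr k) hf.continuous s).mass).toReal) atTop
        (𝓝 0) := by
      have := (ENNReal.tendsto_toReal ENNReal.zero_ne_top).comp hM0
      rw [ENNReal.toReal_zero] at this
      exact this
    have hev : ∀ᶠ k in atTop, ((hRr k).slice (hdRr k) hf.continuous s).mass < 1 :=
      (tendsto_order.1 hM0).2 1 one_pos
    refine squeeze_zero_norm' ?_ hM0'
    filter_upwards [hev] with k hk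
    rw [Real.norm_eq_abs]
    have := ((hRr k).slice (hdRr k) hf.continuous s).abs_apply_le_mul_toReal_mass hk.ne_top one_pos hχn
    rwa [one_mul] at this
  /- Step 3b: the ball values of `∂Qₖ` are integers, a.e. radius. -/
  have hQint : ∀ᵐ r : ℝ, 0 < r → ∀ k, ∃ mk : ℤ,
      (hdQr' k).restrictSet (closedBall x r) measurableSet_closedBall χ = mk := by
    have h1 : ∀ k, ∀ᵐ r : ℝ, 0 < r → ∃ mk : ℤ,
        (hdQr' k).restrictSet (closedBall x r) measurableSet_closedBall χ = mk := by
      intro k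
      filter_upwards [(hQr k).ae_isRectifiable_sphereSlice b (hεpos k) (hQskel k) (hdQ k) x]
        with r hr hr0
      have hσr := hr hr0
      set σ : Current (⊤ : Opens V) 0 :=
        ((hQr' k).restrictSet (closedBall x r) measurableSet_closedBall).boundary -
          (hdQr' k).restrictSet (closedBall x r) measurableSet_closedBall with hσdef
      have hσr' : σ.IsRectifiable := hσr
      obtain ⟨F, nF, hFσ, hσF, -⟩ := hσr'.exists_finset_eq_currentOfIntegration
      have hσU : σ.support ⊆ U := by
        rw [hσdef, sub_eq_add_neg]
        refine (Current.support_add_subset _ _).trans (union_subset ?_ ?_)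
        · exact ((Current.support_boundary_subset _).trans
            ((hQr' k).support_restrictSet_subset _)).trans (hQU k)
        · rw [Current.support_neg]
          exact (((hdQr' k).support_restrictSet_subset _).trans
            ((Q k).support_boundary_subset)).trans (hQU k)
      have hσχ : σ χ = ∑ z ∈ F, (nF z : ℝ) := by
        rw [hσF, currentOfIntegration_finset_apply]
        exact Finset.sum_congr rfl fun z hz => by rw [hχ1 z (hσU (hFσ hz)), mul_one]
      have h0 : (hQr' k).restrictSet (closedBall x r) measurableSet_closedBall
          (TestForm.extDerivCLM χ) = 0 :=
        (hQr' k).restrictSet_apply_eq_zero_of_eqOn_support (hQr k).mass_ne_top' _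
          fun y hy => hdχ y (hQU k hy)
      have hσχ' : σ χ = -((hdQr' k).restrictSet (closedBall x r) measurableSet_closedBall χ) := by
        rw [hσdef, show ∀ (A B : Current (⊤ : Opens V) 0), (A - B) χ = A χ - B χ from fun _ _ => rfl,
          Current.boundary_apply, h0, zero_sub]
      refine ⟨-∑ z ∈ F, nF z, ?_⟩
      push_cast
      rw [← hσχ, hσχ', neg_neg]
    exact (ae_all_iff.2 h1).mono fun r hr hr0 k => hr k hr0
  /- Step 3c: the ball values of `∂Rₖ` are slice values. -/
  have hRid : ∀ k {r : ℝ}, 0 < r →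
      (hdRr k).restrictSet (closedBall x r) measurableSet_closedBall χ =
        -((hRr k).slice (hdRr k) hf.continuous (r ^ 2) χ) := by
    intro k r hr0
    have hset : {y | r ^ 2 < f y} = (closedBall x r)ᶜ := by
      ext y
      simp only [hfdef, mem_setOf_eq, mem_compl_iff, mem_closedBall, not_le, dist_eq_norm]
      exact sq_lt_sq₀ hr0.le (norm_nonneg _)
    have hmc : MeasurableSet (closedBall x r)ᶜ := measurableSet_closedBall.compl
    rw [Current.IsRepresentable.slice_apply, restrictSet_congr_set'' (hdRr k) _ hmc hset,
      restrictSet_congr_set'' (hRr k) _ hmc hset,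
      (hRr k).restrictSet_apply_eq_zero_of_eqOn_support (hRm' k) hmc
        (fun y hy => hdχ y (hRU k hy)), sub_zero]
    have hsplit := DFunLike.congr_fun
      ((hdRr k).restrictSet_add_compl (measurableSet_closedBall (x := x) (ε := r))) χ
    have h0 : (R k).boundary χ = 0 := by
      rw [Current.boundary_apply]
      exact (R k).apply_eq_zero_of_disjoint_support (hdχ_disj _ (hRU k))
    rw [show ∀ (A B : Current (⊤ : Opens V) 0), (A + B) χ = A χ + B χ from fun _ _ => rfl, h0]
      at hsplit
    linarith
  /- Step 3d: `∂S ⌞ 𝐁 = ∂Qₖ ⌞ 𝐁 + ∂Rₖ ⌞ 𝐁`. -/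
  have hadd : ∀ k {r : ℝ}, 0 < r →
      hdSr.restrictSet (closedBall x r) measurableSet_closedBall χ =
        (hdQr' k).restrictSet (closedBall x r) measurableSet_closedBall χ +
          (hdRr k).restrictSet (closedBall x r) measurableSet_closedBall χ := fun k r hr0 =>
    hdSr.restrictSet_closedBall_add_apply (hdQr' k) (hdRr k) (by rw [hdR k]; abel) x hr0.le χ
  /- Step 3e: good levels transported to radii; conclusion. -/
  obtain ⟨N, -, hN0, hN⟩ : ∃ N : Set ℝ, MeasurableSet N ∧ volume N = 0 ∧ ∀ s ∉ N, 0 < s →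
      Tendsto (fun k => (hRr k).slice (hdRr k) hf.continuous s χ) atTop (𝓝 0) := by
    have h := hRslice
    rw [ae_iff] at h
    refine ⟨toMeasurable volume _, measurableSet_toMeasurable _ _, by rwa [measure_toMeasurable],
      fun s hs => ?_⟩
    have : ¬¬(_ → _) := fun h' => hs (subset_toMeasurable _ _ h')
    exact not_not.1 this
  have hgdiff : DifferentiableOn ℝ Real.sqrt (N ∩ Ioi 0) := fun s hs =>
    (Real.hasDerivAt_sqrt (ne_of_gt hs.2)).differentiableAt.differentiableWithinAt
  have himg0 : volume (Real.sqrt '' (N ∩ Ioi 0)) = 0 :=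
    addHaar_image_eq_zero_of_differentiableOn_of_addHaar_eq_zero volume hgdiff
      (measure_mono_null inter_subset_left hN0)
  filter_upwards [hQint, measure_eq_zero_iff_ae_notMem.1 himg0] with r hQi hrN hr0
  have hsN : r ^ 2 ∉ N := fun h =>
    hrN ⟨r ^ 2, ⟨h, by simp only [mem_Ioi]; positivity⟩, by rw [Real.sqrt_sq hr0.le]⟩
  have hconvR := hN _ hsN (by positivity)
  choose mk hmk using hQi hr0
  set ν := hdSr.restrictSet (closedBall x r) measurableSet_closedBall χ with hν
  have hνk : ∀ k, (mk k : ℝ) = ν + (hRr k).slice (hdRr k) hf.continuous (r ^ 2) χ := fun k => by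
    rw [hν, hadd k hr0, hRid k hr0, ← hmk k]; ring
  have hlim : Tendsto (fun k => (mk k : ℝ)) atTop (𝓝 ν) := by
    have := (tendsto_const_nhds (x := ν)).add hconvR
    rw [add_zero] at this
    exact this.congr fun k => (hνk k).symm
  have hmem : ν ∈ range ((↑) : ℤ → ℝ) :=
    Int.isClosedEmbedding_coe_real.isClosed_range.mem_of_tendsto hlim
      (Eventually.of_forall fun k => ⟨mk k, rfl⟩)
  obtain ⟨m, hm⟩ := hmem
  exact ⟨m, hm.symm⟩

/-- **Boundary rectifiability, induction step** [Federer1969, 4.2.16 (2)]: if the boundary of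
every `S' ∈ 𝓡_{k+1}(V)` with `𝐌(∂S') < ∞` is rectifiable, then so is the boundary of every
`S ∈ 𝓡_{k+2}(V)` with `𝐌(∂S) < ∞` — the cycles `∂Qᵢ` of the skeleton retractions
(`Current.IsRectifiable.exists_skeleton_retract`) converge weakly to `∂S` with bounded masses
and supports, their sphere slices are `−∂σ` for the rectifiable `(k+1)`-currents
`σ = ∂(Qᵢ ⌞ 𝐁) − ∂Qᵢ ⌞ 𝐁` (`Current.IsRectifiable.ae_isRectifiable_sphereSlice`) of a.e. finite
boundary mass, hence rectifiable by hypothesis, and the closure theorem for cycles with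
rectifiable slices (`Current.isRectifiable_of_tendsto_cycles_of_slices`) applies.
[cite: Federer1969, 4.2.16; White1989, Thm. 1.6, §1.5; Bandara2006, Thm. 4.2.2] -/
theorem Current.IsRectifiable.isRectifiable_boundary_succ {k : ℕ}
    (ih : ∀ S' : Current (⊤ : Opens V) (k + 1), S'.IsRectifiable → S'.boundary.mass ≠ ⊤ →
      S'.boundary.IsRectifiable)
    {S : Current (⊤ : Opens V) (k + 1 + 1)} (hS : S.IsRectifiable) (hdS : S.boundary.mass ≠ ⊤) :
    S.boundary.IsRectifiable := by
  classical
  set n := Module.finrank ℝ V with hn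
  rcases Nat.lt_or_ge n (k + 1 + 1) with hlt | hkn
  · rw [Current.eq_zero_of_finrank_lt (m := k + 1 + 1) (by omega) S, Current.boundary_zero]
    exact Current.isRectifiable_zero
  set b := stdOrthonormalBasis ℝ V
  obtain ⟨γ, γ', hγ, hγ', hret⟩ := Current.IsRectifiable.exists_skeleton_retract b hkn
  set ε : ℕ → ℝ := fun i => (1 / 2 : ℝ) ^ (i + 1) with hεdef
  have hεpos : ∀ i, 0 < ε i := fun i => by positivity
  have hεle : ∀ i, ε i ≤ 1 := fun i => pow_le_one₀ (by norm_num) (by norm_num)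
  have hεlim : Tendsto ε atTop (𝓝 0) := by
    have := (tendsto_pow_atTop_nhds_zero_of_lt_one (r := (1 / 2 : ℝ)) (by norm_num) (by norm_num)).comp
      (tendsto_add_atTop_nat 1)
    exact this
  have hex := fun i => hret (hεpos i) hS hdS
  choose Q R hQr hQskel hdQm hdQsupp hdec hRm using hex
  have hc : ENNReal.ofReal γ * S.boundary.mass ≠ ⊤ := ENNReal.mul_ne_top ENNReal.ofReal_ne_top hdS
  have hdQ : ∀ i, (Q i).boundary.mass ≠ ⊤ := fun i => ne_top_of_le_ne_top hc (hdQm i)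
  have hRm' : ∀ i, (R i).mass ≠ ⊤ := fun i =>
    ne_top_of_le_ne_top (ENNReal.mul_ne_top ENNReal.ofReal_ne_top hdS) (hRm i)
  have hdQr' : ∀ i, (Q i).boundary.IsRepresentable := fun i =>
    (Q i).boundary.isRepresentable_of_mass_ne_top (hdQ i)
  have hQr' : ∀ i, (Q i).IsRepresentable := fun i =>
    (Q i).isRepresentable_of_mass_ne_top (hQr i).mass_ne_top'
  -- the compact set containing all supports
  set K : Set V := cthickening (3 * Real.sqrt n) S.support with hK
  have hKc : IsCompact K := hS.2.cthickening
  have hZK : ∀ i, (Q i).boundary.support ⊆ K := fun i =>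
    ((hdQsupp i).trans (cthickening_subset_of_subset _ S.support_boundary_subset)).trans
      (cthickening_mono (by nlinarith [Real.sqrt_nonneg n, hεle i, hεpos i]) _)
  refine Current.isRectifiable_of_tendsto_cycles_of_slices (k := k) (by omega) hKc hc
    (Z := fun i => (Q i).boundary) (T' := S.boundary)
    (fun i => ⟨(Q i).boundary_boundary, hZK i, hdQm i⟩) (fun i x => ?_) (fun φ => ?_)
  · /- sphere slices of the cycles `∂Qᵢ` are rectifiable, a.e. radius -/
    have hddQ : (Q i).boundary.boundary.IsRepresentable := by
      rw [Current.boundary_boundary]; exact Current.isRepresentable_zero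
    have hbm := (hdQr' i).ae_mass_boundary_restrictSet_lt_top hddQ (LipschitzWith.dist_left x)
      (hdQ i) (by rw [Current.boundary_boundary, Current.mass_zero]; exact ENNReal.zero_ne_top)
    filter_upwards [(hQr i).ae_isRectifiable_sphereSlice b (hεpos i) (hQskel i) (hdQ i) x, hbm]
      with r hr hbr hr0
    have hσr := hr hr0
    set Y := (hdQr' i).restrictSet (closedBall x r) measurableSet_closedBall with hY
    set σ : Current (⊤ : Opens V) (k + 1) :=
      ((hQr' i).restrictSet (closedBall x r) measurableSet_closedBall).boundary - Y with hσdef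
    have hσr' : σ.IsRectifiable := hσr
    -- `∂Y = −∂(∂Qᵢ ⌞ 𝐁ᶜ)` has finite mass
    have hset2 : {y | r < dist y x} = (closedBall x r)ᶜ := by
      ext y; simp [mem_closedBall, not_le]
    have hmc : MeasurableSet (closedBall x r)ᶜ := measurableSet_closedBall.compl
    have hYsplit := (hdQr' i).restrictSet_add_compl (measurableSet_closedBall (x := x) (ε := r))
    have hdY : Y.boundary = -((hdQr' i).restrictSet (closedBall x r)ᶜ hmc).boundary := by
      have := congrArg Current.boundary hYsplit
      rw [Current.boundary_add, Current.boundary_boundary] at this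
      exact eq_neg_of_add_eq_zero_left this
    have hdYm : Y.boundary.mass ≠ ⊤ := by
      rw [hdY, Current.mass_neg, ← restrictSet_congr_set'' (hdQr' i)
        (measurableSet_lt_of_continuous (LipschitzWith.dist_left x).continuous r) hmc hset2]
      exact hbr.ne
    -- `∂σ = −∂Y`, so `𝐌(∂σ) < ∞`, `∂σ ∈ 𝓡_k` by hypothesis, and `∂Y = −∂σ`
    have hdσ : σ.boundary = -Y.boundary := by
      rw [hσdef, Current.boundary_sub, Current.boundary_boundary, zero_sub]
    have hdσm : σ.boundary.mass ≠ ⊤ := by rw [hdσ, Current.mass_neg]; exact hdYm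
    have hdσr := ih σ hσr' hdσm
    have : Y.boundary = -σ.boundary := by rw [hdσ, neg_neg]
    show Y.boundary.IsRectifiable
    rw [this]
    exact hdσr.neg
  · /- weak convergence `∂Qᵢ → ∂S` -/
    obtain ⟨C, hC, hCφ⟩ := TestForm.exists_pos_forall_norm_le (TestForm.extDerivCLM φ)
    have hdR : ∀ i, (Q i).boundary φ = S.boundary φ - R i (TestForm.extDerivCLM φ) := fun i => by
      have := DFunLike.congr_fun (hdec i) φ
      rw [show ∀ (A B : Current (⊤ : Opens V) (k + 1)), (A - B) φ = A φ - B φ from fun _ _ => rfl,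
        Current.boundary_apply (R i)] at this
      linarith
    simp_rw [hdR]
    rw [show 𝓝 (S.boundary φ) = 𝓝 (S.boundary φ - 0) by rw [sub_zero]]
    refine (tendsto_const_nhds.sub ?_)
    have hto0 : Tendsto (fun i => C * (ENNReal.ofReal (ε i * γ') * S.boundary.mass).toReal) atTop
        (𝓝 0) := by
      have h1 : Tendsto (fun i => ε i * γ' * S.boundary.mass.toReal) atTop (𝓝 0) := by
        have := (hεlim.mul_const γ').mul_const S.boundary.mass.toReal
        simpa using this
      have := h1.const_mul C
      rw [mul_zero] at this
      refine this.congr fun i => ?_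
      rw [ENNReal.toReal_mul, ENNReal.toReal_ofReal (mul_nonneg (hεpos i).le hγ')]
    refine squeeze_zero_norm (fun i => ?_) hto0
    rw [Real.norm_eq_abs]
    refine ((R i).abs_apply_le_mul_toReal_mass (hRm' i) hC hCφ).trans ?_
    exact mul_le_mul_of_nonneg_left (ENNReal.toReal_mono
      (ENNReal.mul_ne_top ENNReal.ofReal_ne_top hdS) (hRm i)) hC.le

/-- **Federer's boundary rectifiability theorem** [Federer1969, 4.2.16 (2)]:
`𝓡_{m+1}(V) ∩ {S : 𝐌(∂S) < ∞} ⊆ 𝐈_{m+1}(V)` — the boundary of a rectifiable current with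
boundary of finite mass is rectifiable. Discharge of the named fact
`Federer1969_boundaryRectifiability` by induction on `m` (B. White's proof via slicing and the
deformation theorem: `Current.IsRectifiable.isRectifiable_boundary_one`,
`Current.IsRectifiable.isRectifiable_boundary_succ`).
[cite: Federer1969, 4.2.16; White1989, §1.5; Bandara2006, Thm. 4.2.2] -/
theorem Federer1969_boundaryRectifiability_holds : Federer1969_boundaryRectifiability := by
  intro V _ _ _ _ _ m
  induction m with
  | zero => intro S hS hdS; exact hS.isRectifiable_boundary_one hdS
  | succ k ih => intro S hS hdS; exact hS.isRectifiable_boundary_succ ih hdS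

end Proof

end Literature.Geometry.GeometricMeasureTheory
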